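import Mathlib.Dynamics.PeriodicPts.Defs
import Mathlib.Data.Set.Card
import Literature.NumberTheory.DiophantineGeometry.AbcWave0
import HarnessLib

/-!
# Dynamical uniform boundedness for `z ^ d + c` from the abc conjecture (Looper 2021)

Topic `Literature/NumberTheory/DiophantineGeometry` (arithmetic dynamics meets abc). Named fact
requested by work item `wi-20041` (idea card `ABC/ABC/dynamical-ubc-unicritical-rung`: its
contrapositive is a kill link for the abc summit).

N. R. Looper, *Dynamical uniform boundedness and the abc-conjecture*, Invent. Math. 225 (2021)
1–44 (arXiv:1901.04385), Theorem 1.2, read on the held arXiv text (p. 2):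

> **Theorem 1.2.** Let `K` be a number field or a one-variable function field of characteristic
> zero, and let `d ≥ 2`. Let `f(z) = z^d + c ∈ K[z]`, where `f` is not isotrivial if `K` is a
> function field. If `d ≥ 5` and `K` is a number field, assume the abc-conjecture for `K`. If
> `2 ≤ d ≤ 4`, assume the abcd-conjecture (Conjecture 2.1). There is a `B = B(d, K)` such that `f`
> has at most `B` preperiodic points contained in `K`.

We record the case `K = ℚ`, `d ≥ 5` (standard abc only), as the named fact `looper2021`:
`abc (strong Masser–Oesterlé form over ℚ) → UBCUnicritical d` for every `d ≥ 5`, where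
`UBCUnicritical d := ∃ B, ∀ c : ℚ, #{z ∈ ℚ preperiodic for z ↦ z^d + c} ≤ B` is the
Morton–Silverman uniform boundedness statement for the unicritical family (Looper's Conj. 1.1 with
`N = 1`, `K = ℚ`, restricted to `z^d + c`).

* The abc hypothesis is written out as the literal sentence of `Literature.Abc.ABCConjecture`
  (`Summits/ABC/ABC/Statement.lean`, which Literature files may not import): `∀ ε > 0, ∃ C > 0,
  ∀ abc triples, c < C · rad(abc)^{1+ε}` with `IsABCTriple`, `rad` from `AbcWave0.lean`; so
  `looper2021_holds d hd : ABC → UBCUnicritical d` typechecks by unfolding.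
* Preperiodic = some iterate is periodic (Mathlib `Function.periodicPts`); the count uses
  `Set.encard` (value `⊤` on an infinite set, so `≤ B` also asserts finiteness — no `ncard` junk).
* Not recorded here: the `2 ≤ d ≤ 4` clause (it needs Looper's 4-term abcd Conjecture 2.1, a case of
  Vojta's conjecture with truncated counting function, which the tree does not have), the number-field
  and function-field versions, and Doyle–Poonen's reduction of preperiodic to periodic points.

## Mathlib / tree search

Mathlib has `Function.IsPeriodicPt`, `Function.periodicPts`, `Function.minimalPeriod`
(`Mathlib/Dynamics/PeriodicPts/Defs.lean`) but no preperiodic points and no arithmetic dynamics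
(`lean search 'reperiodic|MortonSilverman'`: nothing in Mathlib or the tree). `IsABCTriple`, `rad`
are the tree's (`AbcWave0.lean`). Nothing here restates an existing declaration.
-/

namespace Literature.NumberTheory.DiophantineGeometry

open Function Set

/-- `x` is a **preperiodic point** of `f : α → α`: some forward iterate `f^[n] x` is periodic
(equivalently, the forward orbit of `x` is finite). Looper 2021, §1 (the objects counted in
Conj. 1.1 / Thm. 1.2); Silverman, *The Arithmetic of Dynamical Systems*, §0.
[cite: Looper2021, §1 (Conj. 1.1, Thm. 1.2: preperiodic points)] -/
def IsPreperiodicPt {α : Type*} (f : α → α) (x : α) : Prop :=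
  ∃ n : ℕ, f^[n] x ∈ periodicPts f

/-- A periodic point is preperiodic (`n = 0`). [folklore] -/
theorem IsPreperiodicPt.of_mem_periodicPts {α : Type*} {f : α → α} {x : α}
    (hx : x ∈ periodicPts f) : IsPreperiodicPt f x :=
  ⟨0, by simpa using hx⟩

/-- A fixed point is preperiodic. [folklore] -/
theorem IsPreperiodicPt.of_isFixedPt {α : Type*} {f : α → α} {x : α} (hx : IsFixedPt f x) :
    IsPreperiodicPt f x :=
  .of_mem_periodicPts (mem_periodicPts.2 ⟨1, one_pos, hx.isPeriodicPt 1⟩)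

/-- The **unicritical polynomial map** `f_{d,c}(z) = z ^ d + c` on `ℚ` (Looper 2021, Thm. 1.2).
[cite: Looper2021, Thm. 1.2] -/
def unicritical (d : ℕ) (c : ℚ) : ℚ → ℚ := fun z => z ^ d + c

/-- Unfolding `unicritical`. [folklore] -/
@[simp] theorem unicritical_apply (d : ℕ) (c z : ℚ) : unicritical d c z = z ^ d + c := rfl

/-- The set of **rational preperiodic points** of `z ↦ z ^ d + c`. [cite: Looper2021, Thm. 1.2] -/
def ratPreperiodicPts (d : ℕ) (c : ℚ) : Set ℚ := {z | IsPreperiodicPt (unicritical d c) z}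

/-- Membership in `ratPreperiodicPts`. [folklore] -/
theorem mem_ratPreperiodicPts {d : ℕ} {c z : ℚ} :
    z ∈ ratPreperiodicPts d c ↔ IsPreperiodicPt (unicritical d c) z := Iff.rfl

/-- Sanity check (non-vacuity of the counted sets): `0` is a rational preperiodic point of
`z ↦ z ^ d` (`c = 0`), being fixed. [folklore] -/
theorem zero_mem_ratPreperiodicPts (d : ℕ) (hd : d ≠ 0) : (0 : ℚ) ∈ ratPreperiodicPts d 0 :=
  .of_isFixedPt (show unicritical d 0 0 = 0 by simp [hd])

/-- **Morton–Silverman uniform boundedness for the unicritical family of degree `d` over `ℚ`**: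
there is `B = B(d)` such that for every `c ∈ ℚ` the map `z ↦ z ^ d + c` has at most `B` rational
preperiodic points (`Set.encard ≤ B`, which also forces finiteness). Looper 2021, Conj. 1.1
(Morton–Silverman) specialised to `N = 1`, `K = ℚ`, `f = z^d + c`; the conclusion of Thm. 1.2.
An OPEN statement for each fixed `d ≥ 2` unconditionally. [cite: Looper2021, Conj. 1.1 and Thm. 1.2] -/
def UBCUnicritical (d : ℕ) : Prop :=
  ∃ B : ℕ, ∀ c : ℚ, (ratPreperiodicPts d c).encard ≤ B

/-- **Looper 2021, Theorem 1.2 (case `K = ℚ`, `d ≥ 5`).** Assuming the abc conjecture over `ℚ`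
in its strong Masser–Oesterlé form — literally the sentence of `Literature.Abc.ABCConjecture` /
the summit statement `ABC`: for every `ε > 0` there is `C > 0` with `c < C · rad(abc)^{1+ε}` for all
coprime positive `a + b = c` — the unicritical family `z ↦ z ^ d + c` of any degree `d ≥ 5` has
uniformly boundedly many rational preperiodic points. (For `2 ≤ d ≤ 4` the paper needs the
stronger abcd conjecture, not recorded here.) Named fact (published theorem, not proved in the
tree); users take `(h : looper2021)`. [cite: Looper2021, Thm. 1.2 (K = ℚ, d ≥ 5)] -/
def looper2021 : Prop :=
  ∀ d : ℕ, 5 ≤ d →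
    (∀ ε : ℝ, 0 < ε → ∃ C : ℝ, 0 < C ∧
        ∀ a b c : ℕ, IsABCTriple a b c → (c : ℝ) < C * ((rad a b c : ℕ) : ℝ) ^ (1 + ε)) →
      UBCUnicritical d

/-- Contrapositive reading used by the abc summit's idea card: a degree `d ≥ 5` for which the
unicritical family violates uniform boundedness refutes abc (from the named fact). [cite: Looper2021, Thm. 1.2] -/
theorem not_abc_of_not_UBCUnicritical (h : looper2021) {d : ℕ} (hd : 5 ≤ d)
    (hU : ¬ UBCUnicritical d) :
    ¬ (∀ ε : ℝ, 0 < ε → ∃ C : ℝ, 0 < C ∧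
        ∀ a b c : ℕ, IsABCTriple a b c → (c : ℝ) < C * ((rad a b c : ℕ) : ℝ) ^ (1 + ε)) :=
  fun habc => hU (h d hd habc)

end Literature.NumberTheory.DiophantineGeometry
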